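import Summits.BirchSwinnertonDyer.BirchSwinnertonDyer.Theses.KolyvaginRoadThree

/-!
# Glue item 19416 `PublishedInputsKolyThreeOfParts` of route KOLY `KolyvaginRoadThree` (operator E2 split, k = 17, rev 6)

The seventeen alias/rest children of `PublishedInputsKolyThree`, in the gate's order, reassemble the parent
(pure bookkeeping). Planner g24 staged; any prover hand lands it with
`ledger propose --kind proof --target Summits/BirchSwinnertonDyer/BirchSwinnertonDyer/Theorems/KolyvaginRoadThreePublishedInputsKolyThreeOfParts.lean
 --file <this file> --workitem stmt-BirchSwinnertonDyer-19416`.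
-/

namespace Summit.BirchSwinnertonDyer.BirchSwinnertonDyer.Theorems

open Summit.BirchSwinnertonDyer.BirchSwinnertonDyer.Theses.KolyvaginRoadThree in
/-- Glue item stmt-BirchSwinnertonDyer-19416: the split children, in the gate's order, give back the parent conjunction (reordering of conjuncts only; no mathematics). -/
theorem kolyvaginRoadThree_publishedInputsKolyThreeOfParts_holds :
    Summit.BirchSwinnertonDyer.BirchSwinnertonDyer.Theses.KolyvaginRoadThree.PublishedInputsKolyThreeOfParts :=
  fun h4 h5 h6 h7 h8 h9 h10 h12 h13 h14 h15 h16 h17 h18 h20 hMc hR => by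
    obtain ⟨h1, h2, h3, h11, h19, hrec, hKD⟩ := hR
    exact ⟨⟨h1, h2, h3, h4, h5, h6, h7, h8, h9, h10, h11, h12, h13, h14, h15, h16, h17, h18, h19, h20⟩, hMc, hrec, hKD⟩

end Summit.BirchSwinnertonDyer.BirchSwinnertonDyer.Theorems
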